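import Literature.NumberTheory.Transcendental.KZCubeProducts
import Literature.NumberTheory.Transcendental.BoxIntegralZetaValues
import Literature.NumberTheory.Transcendental.BoxCoordinatePowerMap
import Mathlib.Analysis.SpecialFunctions.Integrability.Basic

/-!
# Ladder engine: the integrability toolkit (crux `HurwitzSectorComplement`, line `chebyshev-level-deformation`,
# stub S1 `stub_ladderEngine` — absolute integrability of the band and ladder integrands)

Every integrand met by the ladder engine on a base `box^m × D` (the Newton–Leibniz bands of the T- and
U-steps, the Fubini `ζ`-part `W(y)/(1−p)`, the output kernels `W(y)ω(y₀)U(y₀,p′)`, `W(y)ω(y₀)T(y₀,p′)`)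
is dominated by a PRODUCT `g₁(x)·g₂(y)` with `g₁(x) = (1 − x₁⋯x_m)^{−e}`, `0 ≤ e < m`, and
`g₂(y) = C·(y_i)^{−1/2}` (or a constant) on a bounded set (file `…StubLadderEngineKit.lean`). Here:

* `integrableOn_box_one_sub_prod_rpow_neg` — `(1 − ∏ xᵢ)^{−e}` is integrable on the open box `(0,1)^m`
  for rational `0 ≤ e < m` (domination by the cube Beta integrand `∏ (1 − xᵢ)^{−e/m}`,
  `KZ.integrableOn_cubeBetaIntegrand`, since `1 − ∏ xᵢ ≥ 1 − xⱼ`);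
* `integrableOn_rpow_neg_apply` — `(y i)^{−e}` (`e < 1`) is integrable on every bounded set on which
  `y i > 0` (product of one-variable integrals, `Integrable.fintype_prod`);
* `integrableOn_of_dominated_prod` — a function on a subset of the cylinder `A × B ⊆ ℝⁿ⁺ᵈ` dominated by
  `g₁ ⊗ g₂` with `g₁ ∈ L¹(A)`, `g₂ ∈ L¹(B)` is integrable (Tonelli through `KZ.appendMeasurableEquiv`).

No definitions. References: Kontsevich–Zagier, *Periods* (2001), §1.1 (absolute convergence is part of the
data of a representation), §4.1 (Fubini).
-/

noncomputable section

open MeasureTheory Set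
open Literature.NumberTheory.Transcendental

namespace Summit.KontsevichZagierPeriods.Theorems.HurwitzMicroSectorsHurwitzSectorComplement.LadderEngine

/-! ## `(1 − ∏ xᵢ)^{−e}` on the open box -/

/-- On the open unit box, `1 − xⱼ ≤ 1 − ∏ xᵢ` for every `j`. [folklore] -/
theorem one_sub_apply_le_one_sub_prod {m : ℕ} {x : Fin m → ℝ} (hx : ∀ i, x i ∈ Ioo (0:ℝ) 1)
    (j : Fin m) : 1 - x j ≤ 1 - ∏ i, x i := by
  have := BoxIntegral.prod_le_apply (fun i => Ioo_subset_Icc_self (hx i)) j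
  linarith

/-- **`(1 − x₁⋯x_m)^{−e} ∈ L¹((0,1)^m)` for rational `0 ≤ e < m`** (`m ≥ 1`): dominated by the cube Beta
integrand `∏ⱼ (1 − xⱼ)^{−e/m}`, each factor integrable since `e/m < 1`.
[cite: KontsevichZagier2001, §1.1] -/
theorem integrableOn_box_one_sub_prod_rpow_neg (m : ℕ) (hm : 1 ≤ m) (e : ℚ) (he0 : 0 ≤ e)
    (hem : (e : ℝ) < m) :
    IntegrableOn (fun x : Fin m → ℝ => (1 - ∏ i, x i) ^ (-(e : ℝ)))
      {x | ∀ i, x i ∈ Ioo (0:ℝ) 1} := by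
  have hm0 : (0:ℝ) < m := by exact_mod_cast hm
  have hmq : (0:ℚ) < m := by exact_mod_cast hm
  -- the dominating cube Beta integrand
  have hdom := KZ.integrableOn_cubeBetaIntegrand (N := m) (fun _ => (1:ℚ)) (fun _ => 1 - e / m)
    (fun _ => ⟨one_pos, by
      have : e / m < 1 := by
        rw [div_lt_one hmq]; exact_mod_cast hem
      linarith⟩)
  have hmeas : MeasurableSet {x : Fin m → ℝ | ∀ i, x i ∈ Ioo (0:ℝ) 1} := BoxIntegral.measurableSet_box m
  -- measurability of our integrand: continuous on the open box
  have hcont : ContinuousOn (fun x : Fin m → ℝ => (1 - ∏ i, x i) ^ (-(e : ℝ)))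
      {x | ∀ i, x i ∈ Ioo (0:ℝ) 1} := by
    refine ContinuousOn.rpow_const (by fun_prop) fun x hx => Or.inl ?_
    have hne : m ≠ 0 := by omega
    have := (BoxIntegral.prod_mem_Ioo hne hx).2
    linarith
  refine Integrable.mono' hdom (hcont.aestronglyMeasurable hmeas) ?_
  rw [ae_restrict_iff' hmeas]
  refine Filter.Eventually.of_forall fun x hx => ?_
  have hne : m ≠ 0 := by omega
  have hp := BoxIntegral.prod_mem_Ioo hne hx
  have h1p : 0 < 1 - ∏ i, x i := by linarith [hp.2]
  rw [Real.norm_eq_abs, abs_of_nonneg (Real.rpow_nonneg h1p.le _)]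
  -- `(1 - ∏ x)^(-e) = ∏_j (1 - ∏ x)^(-e/m) ≤ ∏_j (1 - x j)^(-e/m) = dominating integrand at x`
  have hsplit : (1 - ∏ i, x i) ^ (-(e : ℝ)) = ∏ _j : Fin m, (1 - ∏ i, x i) ^ (-(e : ℝ) / m) := by
    rw [Finset.prod_const, Finset.card_univ, Fintype.card_fin, ← Real.rpow_natCast,
      ← Real.rpow_mul h1p.le]
    congr 1
    field_simp
  rw [hsplit]
  refine Finset.prod_le_prod (fun j _ => Real.rpow_nonneg h1p.le _) fun j _ => ?_
  have hxj := hx j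
  have h1j : 0 < 1 - x j := by linarith [hxj.2]
  have hexp : (((1 - e / m : ℚ) : ℝ) - 1) = -(e : ℝ) / m := by push_cast; ring
  rw [hexp]
  have hx0 : (x j) ^ (((1 : ℚ) : ℝ) - 1) = 1 := by norm_num
  rw [hx0, one_mul]
  exact Real.rpow_le_rpow_of_nonpos h1j (one_sub_apply_le_one_sub_prod hx j)
    (div_nonpos_of_nonpos_of_nonneg (by simpa using he0) hm0.le)

/-! ## `(y i)^{−e}` on bounded sets -/

/-- **`(y i)^{−e} ∈ L¹(S)`** for `e < 1` and any `S ⊆ ℝᵈ` bounded in sup-norm by `R` on which `y i > 0`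
(product over the coordinates of one-variable integrals on `(0, R+1)` resp. `(−R−1, R+1)`). [folklore] -/
theorem integrableOn_rpow_neg_apply {d : ℕ} (i : Fin d) {e : ℝ} (he : e < 1) (R : ℝ)
    {S : Set (Fin d → ℝ)} (hSi : ∀ y ∈ S, 0 < y i) (hSR : ∀ y ∈ S, ∀ j, |y j| ≤ R) :
    IntegrableOn (fun y : Fin d → ℝ => (y i) ^ (-e)) S := by
  -- the enveloping product set
  set I : Fin d → Set ℝ := fun j => if j = i then Ioo 0 (R + 1) else Ioo (-(R + 1)) (R + 1) with hI
  have hSP : S ⊆ Set.pi univ I := by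
    intro y hy j _
    have hR := hSR y hy j
    have habs := abs_le.mp hR
    by_cases hj : j = i
    · subst hj
      simp only [hI, if_true, mem_Ioo]
      exact ⟨hSi y hy, by linarith⟩
    · simp only [hI, hj, if_false, mem_Ioo]
      exact ⟨by linarith, by linarith⟩
  refine IntegrableOn.mono_set ?_ hSP
  -- product structure of the restricted measure
  set φ : Fin d → ℝ → ℝ := fun j u => if j = i then u ^ (-e) else 1 with hφ
  have hprod : (fun y : Fin d → ℝ => (y i) ^ (-e)) = fun y => ∏ j, φ j (y j) := by
    funext y
    rw [Finset.prod_eq_single i (fun j _ hj => by simp [hφ, hj]) (by simp)]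
    simp [hφ]
  rw [hprod, IntegrableOn, volume_pi, Measure.restrict_pi_pi]
  refine Integrable.fintype_prod (f := φ) fun j => ?_
  by_cases hj : j = i
  · subst hj
    have h1 : IntegrableOn (fun u : ℝ => u ^ (-e)) (Ioo 0 (R + 1)) := by
      rcases le_or_gt (R + 1) 0 with hR | hR
      · rw [Ioo_eq_empty (by exact not_lt.mpr hR)]; exact integrableOn_empty
      · exact (intervalIntegral.integrableOn_Ioo_rpow_iff hR).mpr (by linarith)
    simpa [hφ, hI, IntegrableOn] using h1
  · have h1 : IntegrableOn (fun _ : ℝ => (1:ℝ)) (Ioo (-(R + 1)) (R + 1)) :=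
      integrableOn_const (by rw [Real.volume_Ioo]; exact ENNReal.ofReal_ne_top)
    simp only [hφ, hj, if_false]
    exact h1

/-! ## Product domination on a cylinder -/

/-- The cylinder `A × B ⊆ ℝⁿ⁺ᵈ` (first `n` coordinates in `A`, last `d` in `B`) pulls back to `A ×ˢ B` under
`Fin.append`. [folklore] -/
theorem preimage_appendMeasurableEquiv_cylinder {n d : ℕ} (A : Set (Fin n → ℝ)) (B : Set (Fin d → ℝ)) :
    KZ.appendMeasurableEquiv n d ⁻¹'
        {z : Fin (n + d) → ℝ | (fun i => z (Fin.castAdd d i)) ∈ A ∧ (fun j => z (Fin.natAdd n j)) ∈ B} =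
      A ×ˢ B := by
  ext p
  simp

/-- **`g₁ ⊗ g₂ ∈ L¹(A × B)`** for `g₁ ∈ L¹(A)`, `g₂ ∈ L¹(B)` (Tonelli; cf. `KZ.IntegralRep.integrableOn_prodFun`).
[cite: KontsevichZagier2001, §4.1] -/
theorem integrableOn_tensor_cylinder {n d : ℕ} {A : Set (Fin n → ℝ)} {B : Set (Fin d → ℝ)}
    {g₁ : (Fin n → ℝ) → ℝ} {g₂ : (Fin d → ℝ) → ℝ} (hg₁ : IntegrableOn g₁ A) (hg₂ : IntegrableOn g₂ B) :
    IntegrableOn (fun z : Fin (n + d) → ℝ => g₁ (fun i => z (Fin.castAdd d i)) * g₂ (fun j => z (Fin.natAdd n j)))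
      {z | (fun i => z (Fin.castAdd d i)) ∈ A ∧ (fun j => z (Fin.natAdd n j)) ∈ B} := by
  have hint : IntegrableOn (fun p : (Fin n → ℝ) × (Fin d → ℝ) => g₁ p.1 * g₂ p.2) (A ×ˢ B) := by
    rw [IntegrableOn, Measure.volume_eq_prod, ← Measure.prod_restrict]
    exact hg₁.mul_prod hg₂
  have hcomp : (fun z : Fin (n + d) → ℝ => g₁ (fun i => z (Fin.castAdd d i)) * g₂ (fun j => z (Fin.natAdd n j))) ∘
      KZ.appendMeasurableEquiv n d = fun p => g₁ p.1 * g₂ p.2 := by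
    funext p
    simp
  rw [← preimage_appendMeasurableEquiv_cylinder, ← hcomp] at hint
  exact (KZ.volume_preserving_appendMeasurableEquiv.integrableOn_comp_preimage
    (KZ.appendMeasurableEquiv n d).measurableEmbedding).mp hint

/-- **Product domination.** A function on `S ⊆ A × B ⊆ ℝⁿ⁺ᵈ`, a.e.-strongly measurable on `S` and bounded
there by `g₁(x)·g₂(y)` with `g₁ ∈ L¹(A)`, `g₂ ∈ L¹(B)`, is absolutely integrable on `S`.
[cite: KontsevichZagier2001, §1.1] -/
theorem integrableOn_of_dominated_prod {n d : ℕ} {A : Set (Fin n → ℝ)} {B : Set (Fin d → ℝ)}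
    {S : Set (Fin (n + d) → ℝ)} {f : (Fin (n + d) → ℝ) → ℝ} {g₁ : (Fin n → ℝ) → ℝ} {g₂ : (Fin d → ℝ) → ℝ}
    (hg₁ : IntegrableOn g₁ A) (hg₂ : IntegrableOn g₂ B) (hS : MeasurableSet S)
    (hSsub : S ⊆ {z | (fun i => z (Fin.castAdd d i)) ∈ A ∧ (fun j => z (Fin.natAdd n j)) ∈ B})
    (hf : AEStronglyMeasurable f (volume.restrict S))
    (hle : ∀ z ∈ S, |f z| ≤ g₁ (fun i => z (Fin.castAdd d i)) * g₂ (fun j => z (Fin.natAdd n j))) :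
    IntegrableOn f S := by
  have hG := (integrableOn_tensor_cylinder hg₁ hg₂).mono_set hSsub
  refine Integrable.mono' hG hf ?_
  rw [ae_restrict_iff' hS]
  exact Filter.Eventually.of_forall fun z hz => by rw [Real.norm_eq_abs]; exact hle z hz

end Summit.KontsevichZagierPeriods.Theorems.HurwitzMicroSectorsHurwitzSectorComplement.LadderEngine

namespace Summit.KontsevichZagierPeriods.Theorems.HurwitzMicroSectorsHurwitzSectorComplement

/-- **Registered sub-goal of `stub_ladderEngine` (box integrability).** For `m ≥ 1` and rational
`0 ≤ e < m`, `(1 − x₁⋯x_m)^{−e}` is absolutely integrable on the open unit box — the `x`-factor of every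
domination used by the ladder engine (`e = 3/2` for the bands, `e = 1` for the `ζ`-part and the kernels,
`e = 1/2` at the bottom `m = 1`). [cite: KontsevichZagier2001, §1.1] -/
theorem ladderEngine_integrableBox :
    ∀ (m : ℕ) (e : ℚ), 1 ≤ m → 0 ≤ e → (e : ℝ) < m →
      MeasureTheory.IntegrableOn (fun x : Fin m → ℝ => (1 - ∏ i, x i) ^ (-(e : ℝ)))
        {x | ∀ i, x i ∈ Set.Ioo (0:ℝ) 1} :=
  fun m e hm he0 hem => LadderEngine.integrableOn_box_one_sub_prod_rpow_neg m hm e he0 hem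

end Summit.KontsevichZagierPeriods.Theorems.HurwitzMicroSectorsHurwitzSectorComplement

end
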